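import Literature.MathematicalPhysics.QuantumFieldTheory.Balaban1983to89.HaarAnalyticZeroSetNullLocalPi
import Literature.MathematicalPhysics.QuantumFieldTheory.Balaban1983to89.UnitaryModel

/-!
# `Balaban1983to89.HaarAnalyticZeroSetNullLocalGroups` — the open-set (local) real-analytic zero-set nullity AT THE
# LINEAGE'S TYPES: every closed subgroup `Gs ≤ U(N)`, `U(N)` and `SU(N)` themselves (every Haar measure), the products
# `SU(N)^ι` and the gauge-field measure `dU = Π_b dU(b)` of [Balaban1985Averaging] (10) (`Setup.fieldMeasure`)

statement-level skeleton of published theorems with citation tags; proofs where landed; nothing here is a claim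
about the Yang–Mills mass gap

Cell `pub-ymgap` (YM-PLAN Track A), node N09 [B12] width seat `pub-ymgap-dag-n09-w3` (g4), `--supports` K1⁷
`StabilityBAtRecordR13SepCoPH` = stmt-QuantumFields-20542 as a count-neutral helper.  File 4: INSTANCES of the generic
modules `HaarAnalyticZeroSetNullLocal` ∕ `HaarAnalyticZeroSetNullLocalPi` (same seat; [BrockerTomDieck1985] IV (2.11) proof principle «every chart of the manifold G
maps the set … to a set of measure zero in ℝⁿ», chart by chart, for `f` real-analytic only on an open `W ⊆ M_N(ℂ)`) at
the three chart representations of lit-balaban p28's `HaarExponentialChartMeasure`: `isChartRep_unitarySubgroup Gs hG`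
(every CLOSED `Gs ≤ U(N)`, §2 there), `isChartRep_unitaryGroup`, `isChartRep_specialUnitaryGroup` (§3 there) — one
`exact` each; compactness of `U(N)` ∕ `SU(N)` is the tree's `QuantumLattice.GaugeGroups` instances, of `↥Gs` p28's
`HaarSmallBallClosedSubgroup.compactSpace_of_isClosed_subgroup`.  LOCATED CONSUMER: as in the generic module (the
(2.17) ∕ first-form threshold functionals of [Balaban1987RG1] live on the small-field domain only; N07 ∕ (F1) supply the
analyticity there — not claimed here).

CITATION HEADER.  [BrockerTomDieck1985] Th. Bröcker, T. tom Dieck, *Representations of Compact Lie Groups*, GTM 98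
(1985), Ch. IV Thm. (2.11) (proof).  [Mityagin2015] B. S. Mityagin, Math. Notes **107** (2020) ∕ arXiv:1512.07276,
Prop. 1 (PROVED in the tree, consumed through the generic module).  [Helgason2000] Ch. I §1 Thm. 1.14 (13) p. 96
(p28's window formula, consumed through the generic module).  [Balaban1985Averaging] T. Bałaban, CMP **98** (1985)
17–51, (10) p. 19 («dU» = the product of the normalised Haar measures over the bonds = `Setup.fieldMeasure`).

WHAT IS PROVED (theorems only; 0 definitions, 0 named facts, 0 sorry; axioms standard).  For `W ⊆ M_N(ℂ)` open,
`f : M_N(ℂ) → ℂ` with `AnalyticOnNhd ℝ f W`, and ANY Haar measure `μ` on the group: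
* every closed `Gs ≤ U(N)`: ★ `unitarySubgroup_haar_traceZeroSet_diff_flat_eq_zero` (the trace zero set
  `{g : ↑g ∈ W ∧ f ↑g = 0}` is `μ`-null up to its flat locus), ★ `unitarySubgroup_haar_zeroSet_eq_zero_of_isPreconnected`
  (`S ⊆ Gs` preconnected, `↑S ⊆ W`, one non-zero ⇒ `μ{g ∈ S : f ↑g = 0} = 0`), `unitarySubgroup_ae_eventually_eq_zero`;
* `U(N)`: `unitaryGroup_haar_traceZeroSet_diff_flat_eq_zero`, `unitaryGroup_haar_zeroSet_eq_zero_of_isPreconnected`;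
* `SU(N)` (`n` non-empty): ★ `specialUnitaryGroup_haar_traceZeroSet_diff_flat_eq_zero`,
  ★ `specialUnitaryGroup_haar_zeroSet_eq_zero_of_isPreconnected`, `specialUnitaryGroup_ae_eventually_eq_zero`;
* PRODUCTS `SU(N)^ι` (any Haar `μ`, finite `ι`, `W ⊆ M_N(ℂ)^ι` open, `F` real-analytic on `W`):
  ★ `pi_specialUnitaryGroup_traceZeroSet_diff_flat_eq_zero`, ★ `pi_specialUnitaryGroup_zeroSet_eq_zero_of_isPreconnected`;
  THE GAUGE-FIELD MEASURE `dU` (`Setup.fieldMeasure P j (SU N)`, every torus datum `P`, level `j`, `N ≥ 1`; it IS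
  `Measure.pi (fun _ : PBond P j => haar)`, so no transfer homomorphism is needed): ★★ `fieldMeasure_traceZeroSet_diff_flat_eq_zero`
  (`dU{U : U ∈ W ∧ F(U) = 0 ∧ ¬(F vanishes near U)} = 0`), ★★ `fieldMeasure_zeroSet_eq_zero_of_isPreconnected`
  (`S` preconnected set of configurations inside `W`, one non-zero ⇒ `dU{U ∈ S : F(U) = 0} = 0`),
  `fieldMeasure_ae_eventually_eq_zero`.

HONEST SCOPE.  (i) Pure instantiation; nothing of the generic module, of p28's files or of Mathlib is re-proved.
(ii) p28's global theorem `HaarAnalyticZeroSetNull.haar_zeroSet_eq_zero` and dag-n09-w2's product theorems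
(`FieldMeasureAnalyticZeroSetNull.fieldMeasure_zeroSet_eq_zero`, …) are NOT restated (they are the cases `W = univ`).
(iii) Configurations are typed `PBond P j → SU(N)` (= `GaugeField P j (SU N)` by `rfl`), so `𝓝` is the product topology.
(iv) No claim about Bałaban's renormalization group; `hreg`∕`contTOn` stay displayed; N09 is NOT discharged; nothing
continuum ∕ OS ∕ mass gap ∕ Clay.
-/

noncomputable section

open NormedSpace Set Function Filter Topology MeasureTheory
open scoped ENNReal NNReal Matrix.Norms.L2Operator

namespace Literature.MathematicalPhysics.QuantumFieldTheory.Balaban1983to89.HaarAnalyticZeroSetNullLocalGroups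

open HaarExponentialChart HaarExponentialChart.IsChartRep
open LogChartClosedSubgroup (unitarySubgroupLogChart)
open HaarSmallBallClosedSubgroup (compactSpace_of_isClosed_subgroup)
open Literature.MathematicalPhysics.QuantumLattice (unitaryFundamentalRep fundamentalRep)
open HaarAnalyticZeroSetNullLocal HaarAnalyticZeroSetNullLocalPi

variable {n : Type*} [Fintype n] [DecidableEq n]

/-! ## §1 Every closed subgroup `Gs ≤ U(N)` -/

section UnitarySubgroup

variable (Gs : Subgroup (Matrix.unitaryGroup n ℂ)) (hG : IsClosed (Gs : Set (Matrix.unitaryGroup n ℂ)))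
  (μ : Measure Gs) [μ.IsHaarMeasure] {W : Set (Matrix n n ℂ)} {f : Matrix n n ℂ → ℂ}
include hG

/-- ★ For every CLOSED SUBGROUP `Gs ≤ U(N)` and every Haar measure on it: the trace zero set of a function real-analytic
on an open `W ⊆ M_N(ℂ)` is `μ`-null up to its flat locus. [cite: BrockerTomDieck1985, IV (2.11) (proof)]
[cite: Mityagin2015, Proposition 1] [cite: Helgason2000, Ch. I §1 Thm. 1.14 (13) p. 96] -/
theorem unitarySubgroup_haar_traceZeroSet_diff_flat_eq_zero (hW : IsOpen W) (hf : AnalyticOnNhd ℝ f W) :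
    μ {g : Gs | (((g : Gs) : Matrix.unitaryGroup n ℂ) : Matrix n n ℂ) ∈ W ∧
        f (((g : Gs) : Matrix.unitaryGroup n ℂ) : Matrix n n ℂ) = 0 ∧
        ¬ ∀ᶠ g' in 𝓝 g, f (((g' : Gs) : Matrix.unitaryGroup n ℂ) : Matrix n n ℂ) = 0} = 0 := by
  haveI : CompactSpace Gs := compactSpace_of_isClosed_subgroup Gs hG
  exact haar_traceZeroSet_diff_flat_eq_zero μ (isChartRep_unitarySubgroup Gs hG)
    (lie_adStable_unitarySubgroup Gs hG) hW hf

/-- Almost-everywhere form for closed `Gs ≤ U(N)`: `μ`-a.e. zero of `f` on `Gs ∩ W` is a flat point.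
[cite: BrockerTomDieck1985, IV (2.11) (proof)] [cite: Mityagin2015, Proposition 1] -/
theorem unitarySubgroup_ae_eventually_eq_zero (hW : IsOpen W) (hf : AnalyticOnNhd ℝ f W) :
    ∀ᵐ g ∂μ, (((g : Gs) : Matrix.unitaryGroup n ℂ) : Matrix n n ℂ) ∈ W →
      f (((g : Gs) : Matrix.unitaryGroup n ℂ) : Matrix n n ℂ) = 0 →
        ∀ᶠ g' in 𝓝 g, f (((g' : Gs) : Matrix.unitaryGroup n ℂ) : Matrix n n ℂ) = 0 := by
  haveI : CompactSpace Gs := compactSpace_of_isClosed_subgroup Gs hG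
  exact ae_eventually_eq_zero_of_eq_zero μ (isChartRep_unitarySubgroup Gs hG)
    (lie_adStable_unitarySubgroup Gs hG) hW hf

/-- ★ For every CLOSED SUBGROUP `Gs ≤ U(N)`: on a preconnected `S ⊆ Gs` inside `W` carrying one non-zero of `f`,
`μ{g ∈ S : f(g) = 0} = 0`. [cite: BrockerTomDieck1985, IV (2.11) (proof)] [cite: Mityagin2015, Proposition 1]
[cite: Helgason2000, Ch. I §1 Thm. 1.14 (13) p. 96] -/
theorem unitarySubgroup_haar_zeroSet_eq_zero_of_isPreconnected (hW : IsOpen W) (hf : AnalyticOnNhd ℝ f W)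
    {S : Set Gs} (hS : IsPreconnected S)
    (hSW : ∀ g ∈ S, (((g : Gs) : Matrix.unitaryGroup n ℂ) : Matrix n n ℂ) ∈ W)
    (hne : ∃ g₀ ∈ S, f (((g₀ : Gs) : Matrix.unitaryGroup n ℂ) : Matrix n n ℂ) ≠ 0) :
    μ {g ∈ S | f (((g : Gs) : Matrix.unitaryGroup n ℂ) : Matrix n n ℂ) = 0} = 0 := by
  haveI : CompactSpace Gs := compactSpace_of_isClosed_subgroup Gs hG
  exact haar_zeroSet_eq_zero_of_isPreconnected μ (isChartRep_unitarySubgroup Gs hG)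
    (lie_adStable_unitarySubgroup Gs hG) hW hf hS hSW hne

end UnitarySubgroup

/-! ## §2 `U(N)` itself -/

section Unitary

variable (μ : Measure (Matrix.unitaryGroup n ℂ)) [μ.IsHaarMeasure] {W : Set (Matrix n n ℂ)} {f : Matrix n n ℂ → ℂ}

/-- For `U(N)` (chart `isChartRep_unitaryGroup`) and every Haar measure: the trace zero set of a function
real-analytic on an open `W ⊆ M_N(ℂ)` is null up to its flat locus. [cite: BrockerTomDieck1985, IV (2.11) (proof)]
[cite: Mityagin2015, Proposition 1] [cite: Helgason2000, Ch. I §1 Thm. 1.14 (13) p. 96] -/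
theorem unitaryGroup_haar_traceZeroSet_diff_flat_eq_zero (hW : IsOpen W) (hf : AnalyticOnNhd ℝ f W) :
    μ {g : Matrix.unitaryGroup n ℂ | (g : Matrix n n ℂ) ∈ W ∧ f (g : Matrix n n ℂ) = 0 ∧
        ¬ ∀ᶠ g' in 𝓝 g, f ((g' : Matrix.unitaryGroup n ℂ) : Matrix n n ℂ) = 0} = 0 :=
  haar_traceZeroSet_diff_flat_eq_zero μ (isChartRep_unitaryGroup (n := n)) (lie_adStable_unitaryGroup (n := n)) hW hf

/-- For `U(N)`: on a preconnected `S ⊆ U(N)` inside `W` with one non-zero of `f`, `μ{g ∈ S : f(g) = 0} = 0`.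
[cite: BrockerTomDieck1985, IV (2.11) (proof)] [cite: Mityagin2015, Proposition 1]
[cite: Helgason2000, Ch. I §1 Thm. 1.14 (13) p. 96] -/
theorem unitaryGroup_haar_zeroSet_eq_zero_of_isPreconnected (hW : IsOpen W) (hf : AnalyticOnNhd ℝ f W)
    {S : Set (Matrix.unitaryGroup n ℂ)} (hS : IsPreconnected S) (hSW : ∀ g ∈ S, (g : Matrix n n ℂ) ∈ W)
    (hne : ∃ g₀ ∈ S, f (g₀ : Matrix n n ℂ) ≠ 0) :
    μ {g ∈ S | f (g : Matrix n n ℂ) = 0} = 0 :=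
  haar_zeroSet_eq_zero_of_isPreconnected μ (isChartRep_unitaryGroup (n := n)) (lie_adStable_unitaryGroup (n := n))
    hW hf hS hSW hne

end Unitary

/-! ## §3 `SU(N)` itself -/

section SpecialUnitary

variable [Nonempty n] (μ : Measure (Matrix.specialUnitaryGroup n ℂ)) [μ.IsHaarMeasure]
  {W : Set (Matrix n n ℂ)} {f : Matrix n n ℂ → ℂ}

/-- ★ For `SU(N)` (chart `isChartRep_specialUnitaryGroup`) and every Haar measure: the trace zero set of a function
real-analytic on an open `W ⊆ M_N(ℂ)` is null up to its flat locus. [cite: BrockerTomDieck1985, IV (2.11) (proof)]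
[cite: Mityagin2015, Proposition 1] [cite: Helgason2000, Ch. I §1 Thm. 1.14 (13) p. 96] -/
theorem specialUnitaryGroup_haar_traceZeroSet_diff_flat_eq_zero (hW : IsOpen W) (hf : AnalyticOnNhd ℝ f W) :
    μ {g : Matrix.specialUnitaryGroup n ℂ | (g : Matrix n n ℂ) ∈ W ∧ f (g : Matrix n n ℂ) = 0 ∧
        ¬ ∀ᶠ g' in 𝓝 g, f ((g' : Matrix.specialUnitaryGroup n ℂ) : Matrix n n ℂ) = 0} = 0 :=
  haar_traceZeroSet_diff_flat_eq_zero μ (isChartRep_specialUnitaryGroup (n := n))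
    (lie_adStable_specialUnitaryGroup (n := n)) hW hf

/-- Almost-everywhere form for `SU(N)`: `μ`-a.e. zero of `f` on `SU(N) ∩ W` is a flat point.
[cite: BrockerTomDieck1985, IV (2.11) (proof)] [cite: Mityagin2015, Proposition 1] -/
theorem specialUnitaryGroup_ae_eventually_eq_zero (hW : IsOpen W) (hf : AnalyticOnNhd ℝ f W) :
    ∀ᵐ g : Matrix.specialUnitaryGroup n ℂ ∂μ, (g : Matrix n n ℂ) ∈ W → f (g : Matrix n n ℂ) = 0 →
      ∀ᶠ g' in 𝓝 g, f ((g' : Matrix.specialUnitaryGroup n ℂ) : Matrix n n ℂ) = 0 :=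
  ae_eventually_eq_zero_of_eq_zero μ (isChartRep_specialUnitaryGroup (n := n))
    (lie_adStable_specialUnitaryGroup (n := n)) hW hf

/-- ★ For `SU(N)`: on a preconnected `S ⊆ SU(N)` inside `W` with one non-zero of `f`, `μ{g ∈ S : f(g) = 0} = 0`.
[cite: BrockerTomDieck1985, IV (2.11) (proof)] [cite: Mityagin2015, Proposition 1]
[cite: Helgason2000, Ch. I §1 Thm. 1.14 (13) p. 96] -/
theorem specialUnitaryGroup_haar_zeroSet_eq_zero_of_isPreconnected (hW : IsOpen W) (hf : AnalyticOnNhd ℝ f W)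
    {S : Set (Matrix.specialUnitaryGroup n ℂ)} (hS : IsPreconnected S) (hSW : ∀ g ∈ S, (g : Matrix n n ℂ) ∈ W)
    (hne : ∃ g₀ ∈ S, f (g₀ : Matrix n n ℂ) ≠ 0) :
    μ {g ∈ S | f (g : Matrix n n ℂ) = 0} = 0 :=
  haar_zeroSet_eq_zero_of_isPreconnected μ (isChartRep_specialUnitaryGroup (n := n))
    (lie_adStable_specialUnitaryGroup (n := n)) hW hf hS hSW hne

end SpecialUnitary

/-! ## §4 Products `SU(N)^ι` and the gauge-field measure `dU = Π_b dU(b)` -/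

section Products

variable [Nonempty n]

/-- ★ PRODUCT HAAR ON `SU(N)^ι` (any Haar `μ`, finite `ι`): the trace zero set of `F` real-analytic on an open
`W ⊆ M_N(ℂ)^ι` is `(⊗_ι μ)`-null up to its flat locus. [cite: BrockerTomDieck1985, IV (2.11) (proof), I (5.12)]
[cite: Mityagin2015, Proposition 1] [cite: Helgason2000, Ch. I §1 Thm. 1.14 (13) p. 96] -/
theorem pi_specialUnitaryGroup_traceZeroSet_diff_flat_eq_zero (μ : Measure (Matrix.specialUnitaryGroup n ℂ))
    [μ.IsHaarMeasure] {ι : Type*} [Fintype ι] {W : Set (ι → Matrix n n ℂ)} (hW : IsOpen W)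
    {F : (ι → Matrix n n ℂ) → ℂ} (hF : AnalyticOnNhd ℝ F W) :
    Measure.pi (fun _ : ι => μ) {g : ι → Matrix.specialUnitaryGroup n ℂ |
      (fun i => (g i : Matrix n n ℂ)) ∈ W ∧ F (fun i => (g i : Matrix n n ℂ)) = 0 ∧
        ¬ ∀ᶠ g' in 𝓝 g, F (fun i => ((g' i : Matrix.specialUnitaryGroup n ℂ) : Matrix n n ℂ)) = 0} = 0 :=
  pi_traceZeroSet_diff_flat_eq_zero μ (isChartRep_specialUnitaryGroup (n := n))
    (lie_adStable_specialUnitaryGroup (n := n)) hW hF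

/-- ★ PRODUCT HAAR ON `SU(N)^ι`: on a preconnected `S ⊆ SU(N)^ι` inside `W` with one non-zero of `F`,
`(⊗_ι μ){g ∈ S : F(g) = 0} = 0`. [cite: BrockerTomDieck1985, IV (2.11) (proof), I (5.12)] [cite: Mityagin2015, Proposition 1]
[cite: Helgason2000, Ch. I §1 Thm. 1.14 (13) p. 96] -/
theorem pi_specialUnitaryGroup_zeroSet_eq_zero_of_isPreconnected (μ : Measure (Matrix.specialUnitaryGroup n ℂ))
    [μ.IsHaarMeasure] {ι : Type*} [Fintype ι] {W : Set (ι → Matrix n n ℂ)} (hW : IsOpen W)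
    {F : (ι → Matrix n n ℂ) → ℂ} (hF : AnalyticOnNhd ℝ F W) {S : Set (ι → Matrix.specialUnitaryGroup n ℂ)}
    (hS : IsPreconnected S) (hSW : ∀ g ∈ S, (fun i => (g i : Matrix n n ℂ)) ∈ W)
    (hne : ∃ g₀ ∈ S, F (fun i => (g₀ i : Matrix n n ℂ)) ≠ 0) :
    Measure.pi (fun _ : ι => μ) {g ∈ S | F (fun i => (g i : Matrix n n ℂ)) = 0} = 0 :=
  pi_zeroSet_eq_zero_of_isPreconnected μ (isChartRep_specialUnitaryGroup (n := n))
    (lie_adStable_specialUnitaryGroup (n := n)) hW hF hS hSW hne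

end Products

section FieldMeasure

variable {N : ℕ} [NeZero N] (P : Params) (j : ℕ)

/-- The normalised Haar datum of `SU(N)` (`UnitaryModel.instHaarDataSpecialUnitaryGroup`) is a Haar measure. [folklore] -/
private theorem isHaarMeasure_haarData_specialUnitaryGroup :
    (HaarData.haar : Measure (Matrix.specialUnitaryGroup (Fin N) ℂ)).IsHaarMeasure := by
  show (Measure.haarMeasure ⊤).IsHaarMeasure
  infer_instance

/-- ★★ **`dU`-NULLITY UP TO THE FLAT LOCUS FOR GAUGE-FIELD FUNCTIONALS REAL-ANALYTIC ON AN OPEN SET**: for every torus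
datum `P`, level `j`, `N ≥ 1`, every open `W ⊆ (PBond P j → M_N(ℂ))` and every `F` real-analytic on `W`, the
`SU(N)`-configurations `U` with `U ∈ W`, `F(U) = 0` at which `F` does NOT vanish identically nearby form a null set for
`dU = Π_b dU(b)` ([Balaban1985Averaging] (10); `Setup.fieldMeasure`, Haar data `UnitaryModel.instHaarDataSpecialUnitaryGroup`).
[cite: Balaban1985Averaging, (10) p. 19] [cite: BrockerTomDieck1985, IV (2.11) (proof), I (5.12)]
[cite: Mityagin2015, Proposition 1] -/
theorem fieldMeasure_traceZeroSet_diff_flat_eq_zero {W : Set (PBond P j → Matrix (Fin N) (Fin N) ℂ)} (hW : IsOpen W)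
    {F : (PBond P j → Matrix (Fin N) (Fin N) ℂ) → ℂ} (hF : AnalyticOnNhd ℝ F W) :
    fieldMeasure P j (Matrix.specialUnitaryGroup (Fin N) ℂ)
      {U : PBond P j → Matrix.specialUnitaryGroup (Fin N) ℂ |
        (fun b => (U b : Matrix (Fin N) (Fin N) ℂ)) ∈ W ∧ F (fun b => (U b : Matrix (Fin N) (Fin N) ℂ)) = 0 ∧
          ¬ ∀ᶠ U' in 𝓝 U, F (fun b => ((U' b : Matrix.specialUnitaryGroup (Fin N) ℂ) : Matrix (Fin N) (Fin N) ℂ)) = 0}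
      = 0 := by
  haveI := isHaarMeasure_haarData_specialUnitaryGroup (N := N)
  exact pi_traceZeroSet_diff_flat_eq_zero _ (isChartRep_specialUnitaryGroup (n := Fin N))
    (lie_adStable_specialUnitaryGroup (n := Fin N)) hW hF

/-- Almost-everywhere form: `dU`-a.e. configuration `U ∈ W` with `F(U) = 0` is a flat point of `F`.
[cite: Balaban1985Averaging, (10) p. 19] [cite: BrockerTomDieck1985, IV (2.11) (proof)] [cite: Mityagin2015, Proposition 1] -/
theorem fieldMeasure_ae_eventually_eq_zero {W : Set (PBond P j → Matrix (Fin N) (Fin N) ℂ)} (hW : IsOpen W)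
    {F : (PBond P j → Matrix (Fin N) (Fin N) ℂ) → ℂ} (hF : AnalyticOnNhd ℝ F W) :
    ∀ᵐ U : PBond P j → Matrix.specialUnitaryGroup (Fin N) ℂ ∂(fieldMeasure P j (Matrix.specialUnitaryGroup (Fin N) ℂ)),
      (fun b => (U b : Matrix (Fin N) (Fin N) ℂ)) ∈ W → F (fun b => (U b : Matrix (Fin N) (Fin N) ℂ)) = 0 →
        ∀ᶠ U' in 𝓝 U, F (fun b => ((U' b : Matrix.specialUnitaryGroup (Fin N) ℂ) : Matrix (Fin N) (Fin N) ℂ)) = 0 := by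
  haveI := isHaarMeasure_haarData_specialUnitaryGroup (N := N)
  exact ae_pi_eventually_eq_zero_of_eq_zero _ (isChartRep_specialUnitaryGroup (n := Fin N))
    (lie_adStable_specialUnitaryGroup (n := Fin N)) hW hF

/-- ★★ **`dU`-NULLITY ON A PRECONNECTED SET OF CONFIGURATIONS**: for `S` a preconnected set of `SU(N)`-configurations
inside the open `W`, `F` real-analytic on `W` with `F(U₀) ≠ 0` for ONE `U₀ ∈ S`: `dU{U ∈ S : F(U) = 0} = 0`
(dag-n09-w2's `fieldMeasure_zeroSet_eq_zero` is the case `W = S = univ`). [cite: Balaban1985Averaging, (10) p. 19]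
[cite: BrockerTomDieck1985, IV (2.11) (proof), I (5.12)] [cite: Mityagin2015, Proposition 1] -/
theorem fieldMeasure_zeroSet_eq_zero_of_isPreconnected {W : Set (PBond P j → Matrix (Fin N) (Fin N) ℂ)}
    (hW : IsOpen W) {F : (PBond P j → Matrix (Fin N) (Fin N) ℂ) → ℂ} (hF : AnalyticOnNhd ℝ F W)
    {S : Set (PBond P j → Matrix.specialUnitaryGroup (Fin N) ℂ)} (hS : IsPreconnected S)
    (hSW : ∀ U ∈ S, (fun b => (U b : Matrix (Fin N) (Fin N) ℂ)) ∈ W)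
    (hne : ∃ U₀ ∈ S, F (fun b => (U₀ b : Matrix (Fin N) (Fin N) ℂ)) ≠ 0) :
    fieldMeasure P j (Matrix.specialUnitaryGroup (Fin N) ℂ)
      {U ∈ S | F (fun b => (U b : Matrix (Fin N) (Fin N) ℂ)) = 0} = 0 := by
  haveI := isHaarMeasure_haarData_specialUnitaryGroup (N := N)
  exact pi_zeroSet_eq_zero_of_isPreconnected _ (isChartRep_specialUnitaryGroup (n := Fin N))
    (lie_adStable_specialUnitaryGroup (n := Fin N)) hW hF hS hSW hne

end FieldMeasure

end Literature.MathematicalPhysics.QuantumFieldTheory.Balaban1983to89.HaarAnalyticZeroSetNullLocalGroups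

end
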